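import Literature.MathematicalPhysics.QuantumLattice.HeisenbergTorusReflection
import HarnessLib

/-!
# Kennedy–Lieb–Shastry with a third sum rule: an energy-free lower bound on the diagonal-neighbour
# correlation of the square-lattice antiferromagnet, uniformly typed in the side `L`

HONEST FRAMING: ladder R1–R4 with certified numbers; no claim on H/H₀.

Topic `MathematicalPhysics/QuantumLattice` (family `hubbard`, HubbardLadder R2 line "what is proved
rigorously today for the spin-½ square-lattice antiferromagnet"). Sibling of
`HeisenbergOrderNeelTwoSumRule.lean` (`kls_heis_twoSumRule`: the LRO parameter from the total sum
rule (2) and the energy sum rule (3) of Kennedy–Lieb–Shastry, J. Stat. Phys. **53** (1988), with the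
`T = 0` infrared bound (1) = `heis_infraredBound`) and of `HeisenbergOrderNeelShortRange.lean`
(KLS eqs. (10)–(11)). No named fact is introduced; every declaration is a definition with a body or a
proved theorem.

THE THIRD SUM RULE. On the torus `Λ = (ℤ/Lℤ)^d` character orthogonality gives, besides
(2) `|Λ|⁻¹ Σ_q ĝ_q = S(S+1)/3` and (3) `|Λ|⁻¹ Σ_q ĝ_q d⁻¹Σᵢ cos qᵢ = ε`, the DIAGONAL sum rule
(D) `|Λ|⁻¹ Σ_q ĝ_q cos qᵢ cos qⱼ = ½ (c(eᵢ + eⱼ) + c(eᵢ - eⱼ))` (`sum_heisStructureFactor_mul_cos_mul_cos`),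
which on the square torus (`d = 2`) is the diagonal-neighbour correlation `c(1,1) = ⟨Sᶻ_0 Sᶻ_(1,1)⟩`
(`heisRedCorr2 L n 1 1`) by the reflection symmetry `c(1,-1) = c(1,1)`
(`heisRedCorr2_reflect_snd_mod`): `heis_structureFactor_diagSumRule_two`.

THE BOUND. For real weights `(a, b, t)` put `K(q) := a cos q₁ cos q₂ + b (cos q₁ + cos q₂)/2 + t`
(`klsDiagKernel`; `K(Q) = a - b + t` at `Q = (π, π)`). Then `a`·(D) + `b`·(3) + `t`·(2) reads
`|Λ| (a c(1,1) + b ε + t S(S+1)/3) = K(Q) ĝ_Q + Σ_{q ≠ Q} K(q) ĝ_q`, and for `q ≠ Q` the infrared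
bound `0 ≤ ĝ_q ≤ (-ε/2)^{1/2} (E_q/E_{q-Q})^{1/2}` gives `K(q) ĝ_q ≥ -{-K(q)}₊ (-ε/2)^{1/2} (E_q/E_{q-Q})^{1/2}`:
* `kls_heis_diagSumRule` — `K(Q) |Λ|⁻¹ĝ_Q - (-ε/2)^{1/2} 𝓦(L) ≤ a c(1,1) + b ε + t S(S+1)/3`,
  `𝓦(L) := L⁻² Σ_{q ≠ Q} {-K(q)}₊ (E_q/E_{q-Q})^{1/2}` (`klsDiagRiemannSum`);
* `kls_heis_diagSumRule_drop` — if `K(Q) ≥ 0` (drop the Néel term, `ĝ_Q ≥ 0`):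
  `b(-ε) - t S(S+1)/3 - (-ε/2)^{1/2} 𝓦(L) ≤ a c(1,1)`;
* `kls_heis_diagCorr_lower_energyFree` — for `b > 0`, minimising over the unknown `-ε ≥ 0`
  (arithmetic–geometric mean): `-t S(S+1)/3 - 𝓦(L)²/(8b) ≤ a c(1,1)`; the spin-½ form
  `heisRedCorr2_diag_lower_energyFree`: `-t/4 - 𝓦_{1,b,t}(L)²/(8b) ≤ c_L(1,1)` for every even `L ≥ 4`.
No energy bound, no Marshall sign rule and no reflection-positivity cut on correlations is used: the
inputs are (1), (2), (3), (D) and `ĝ ≥ 0`. This is the KLS long-range-order mechanism (infrared caps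
force spectral weight towards `Q`) applied to a SOFT observable — `K ≥ 0` on a neighbourhood of `Q`
suffices — so it yields a strict Néel sign of a short-range correlation for `S = ½, d = 2`, where the
LRO bound itself fails (KLS p. 1023). The numerical content is the evaluation of the explicit finite
sum `𝓦(L)` (device D33 of the HubbardLadder cell: `(a,b,t) = (1, 0.6247, -0.3229)` gives
`c_L(1,1) ≥ 0.0207` at `L = 48` and `≥ 0.0183` for every even `L ≥ 4` by a certified polynomial
majorant of the integrand — numerics of record, NOT part of this file); here `𝓦(L)` stays symbolic and
every theorem quantifies over all even sides `2k ≥ 4` and all spins `n/2`.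
[cite: KLS1988JSP, eqs. (1)-(3), (6)-(9), p. 1023] [cite: DLS1978, Theorem 4.2]
-/

noncomputable section

open Matrix Finset Literature.Probability.LatticeModels
open Literature.MathematicalPhysics.QuantumLattice

namespace Literature.MathematicalPhysics.QuantumLattice

variable {d : ℕ}

/-! ### Positivity of the structure factor at every momentum -/

/-- `ĝ_q ≥ 0` at EVERY dual-torus point (including `Q`): `L^d ĝ_q = Re ω(C_q²) + Re ω(D_q²)` with
`C_q, D_q` Hermitian (`heisStructureFactor_eq_modes`). [Kennedy–Lieb–Shastry 1988, p. 1021, `g_q ≥ 0`]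
[cite: KLS1988JSP, p. 1021] -/
theorem heisStructureFactor_nonneg (L : ℕ) [NeZero L] (n : ℕ) (q : TorusSite d L) :
    0 ≤ heisStructureFactor 0 L n q := by
  have hL : (0 : ℝ) < (L : ℝ) ^ d := by
    have : (0 : ℝ) < L := by exact_mod_cast Nat.pos_of_ne_zero (NeZero.ne L)
    positivity
  have h := heisStructureFactor_eq_modes L n q
  have h1 := re_groundStateFunctional_mul_self_nonneg (heisenbergTorus d L n 1)
    (xyCosMode_isHermitian L n q)
  have h2 := re_groundStateFunctional_mul_self_nonneg (heisenbergTorus d L n 1)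
    (xySinMode_isHermitian L n q)
  have h0 : 0 ≤ heisStructureFactor 0 L n q * (L : ℝ) ^ d := by rw [h]; exact add_nonneg h1 h2
  exact (mul_nonneg_iff_of_pos_right hL).1 h0

/-! ### (D) The diagonal sum rule -/

/-- `|(ℤ/Lℤ)^d| = L^d`. [folklore] -/
private theorem card_torusSite_cast' (L : ℕ) [NeZero L] :
    (Fintype.card (TorusSite d L) : ℝ) = (L : ℝ) ^ d := by
  rw [Fintype.card_pi, prod_const, ZMod.card, card_univ, Fintype.card_fin]
  push_cast
  ring

/-- The structure factor against a general character: `Σ_q ĝ_q cos(p_q·z) = Σ_x G(x, x + z)`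
(character orthogonality, `sum_structureFactor_mul_cos_torusPhase`). [Kennedy–Lieb–Shastry 1988,
eqs. (3), (10)–(11)] [cite: KLS1988JSP, eqs. (3), (10)-(11)] -/
theorem sum_heisStructureFactor_mul_cos_torusPhase (L : ℕ) [NeZero L] (n : ℕ) (z : TorusSite d L) :
    ∑ q : TorusSite d L, heisStructureFactor 0 L n q * Real.cos (torusPhase L q z) =
      ∑ x : TorusSite d L, heisGroundCorr 0 L n x (x + z) := by
  have hL : (L : ℝ) ^ d ≠ 0 := by
    have : (L : ℝ) ≠ 0 := by exact_mod_cast NeZero.ne L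
    positivity
  simp_rw [heisStructureFactor_of_neZero, div_mul_eq_mul_div]
  rw [← sum_div, sum_structureFactor_mul_cos_torusPhase L (heisGroundCorr 0 L n)
    (heisGroundCorr_symm 0 L n) z, mul_div_cancel_left₀ _ hL]

/-- Translation reduction of the shifted diagonal sum: `Σ_x G(x, x + z) = L^d c(z)`, `c(z) = G(0, z)`.
[Kennedy–Lieb–Shastry 1988, p. 1021] [cite: KLS1988JSP, p. 1021] -/
theorem sum_heisGroundCorr_shift (L : ℕ) [NeZero L] (n : ℕ) (z : TorusSite d L) :
    ∑ x : TorusSite d L, heisGroundCorr 0 L n x (x + z) = (L : ℝ) ^ d * heisGroundCorr 0 L n 0 z := by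
  have h : ∀ x : TorusSite d L, heisGroundCorr 0 L n x (x + z) = heisGroundCorr 0 L n 0 z := by
    intro x
    rw [heisGroundCorr_eq_zero_left 0 L n x (x + z), add_sub_cancel_left]
  simp_rw [h, sum_const, card_univ, nsmul_eq_mul, card_torusSite_cast' L]

/-- `cos qᵢ = cos(p_q · eᵢ)` on the discrete torus. [folklore] -/
private theorem cos_latticeMomentum_eq_cos_torusPhase_single (L : ℕ) [NeZero L] (q : TorusSite d L)
    (i : Fin d) :
    Real.cos (latticeMomentum L q i) = Real.cos (torusPhase L q (Pi.single i 1)) := by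
  have h := cos_natCast_mul_latticeMomentum L q i 1
  simp only [Nat.cast_one, one_mul] at h
  exact h

/-- **(D) The diagonal sum rule**, general dimension: for axes `i, j`,
`Σ_q ĝ_q cos qᵢ cos qⱼ = L^d (c(eᵢ + eⱼ) + c(eᵢ - eⱼ))/2` (product-to-sum through the characters of
`(ℤ/Lℤ)^d`, then orthogonality; the companion of KLS's (2) and (3)). [Kennedy–Lieb–Shastry 1988,
eqs. (2)–(3) (method)] [cite: KLS1988JSP, eqs. (2)-(3)] -/
theorem sum_heisStructureFactor_mul_cos_mul_cos (L : ℕ) [NeZero L] (n : ℕ) (i j : Fin d) :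
    ∑ q : TorusSite d L, heisStructureFactor 0 L n q *
        (Real.cos (latticeMomentum L q i) * Real.cos (latticeMomentum L q j)) =
      (L : ℝ) ^ d * (heisGroundCorr 0 L n 0 (Pi.single i 1 + Pi.single j 1) +
        heisGroundCorr 0 L n 0 (Pi.single i 1 - Pi.single j 1)) / 2 := by
  have h : ∀ q : TorusSite d L, heisStructureFactor 0 L n q *
      (Real.cos (latticeMomentum L q i) * Real.cos (latticeMomentum L q j)) =
      (heisStructureFactor 0 L n q * Real.cos (torusPhase L q (Pi.single i 1 + Pi.single j 1)) +
        heisStructureFactor 0 L n q * Real.cos (torusPhase L q (Pi.single i 1 - Pi.single j 1))) / 2 := by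
    intro q
    rw [cos_latticeMomentum_eq_cos_torusPhase_single, cos_latticeMomentum_eq_cos_torusPhase_single,
      cos_torusPhase_mul_cos_torusPhase]
    ring
  simp_rw [h]
  rw [← sum_div, sum_add_distrib, sum_heisStructureFactor_mul_cos_torusPhase,
    sum_heisStructureFactor_mul_cos_torusPhase, sum_heisGroundCorr_shift, sum_heisGroundCorr_shift]
  ring

/-- `(L - 1 : ℕ) = -1` in `ℤ/Lℤ`. [folklore] -/
private theorem zmod_natCast_pred_eq_neg_one_aux (L : ℕ) [NeZero L] : ((L - 1 : ℕ) : ZMod L) = -1 := by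
  have hL : 1 ≤ L := Nat.one_le_iff_ne_zero.2 (NeZero.ne L)
  rw [Nat.cast_sub hL, ZMod.natCast_self, Nat.cast_one, zero_sub]

/-- **(D) on the square torus**: `Σ_q ĝ_q cos q₁ cos q₂ = L² c(1,1)` for every side `L ≥ 2` and every
spin, using the reflection symmetry `c(1,-1) = c(1,1)` (`heisRedCorr2_reflect_snd_mod`).
[Kennedy–Lieb–Shastry 1988, eqs. (2)–(3) (method), p. 1021 ("by the symmetry of the lattice")]
[cite: KLS1988JSP, eqs. (2)-(3)] -/
theorem heis_structureFactor_diagSumRule_two (L : ℕ) [NeZero L] (hL : 2 ≤ L) (n : ℕ) :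
    ∑ q : TorusSite 2 L, heisStructureFactor 0 L n q *
        (Real.cos (latticeMomentum L q 0) * Real.cos (latticeMomentum L q 1)) =
      (L : ℝ) ^ 2 * heisRedCorr2 L n 1 1 := by
  rw [sum_heisStructureFactor_mul_cos_mul_cos]
  have h1 : (Pi.single (0 : Fin 2) (1 : ZMod L) + Pi.single 1 1 : TorusSite 2 L) =
      ![((1 : ℕ) : ZMod L), ((1 : ℕ) : ZMod L)] := by
    ext i; fin_cases i <;> simp
  have h2 : (Pi.single (0 : Fin 2) (1 : ZMod L) - Pi.single 1 1 : TorusSite 2 L) =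
      ![((1 : ℕ) : ZMod L), ((L - 1 : ℕ) : ZMod L)] := by
    rw [zmod_natCast_pred_eq_neg_one_aux]
    ext i; fin_cases i <;> simp
  have hc : heisGroundCorr 0 L n 0 ![((1 : ℕ) : ZMod L), ((L - 1 : ℕ) : ZMod L)] =
      heisRedCorr2 L n 1 1 := by
    have hr := heisRedCorr2_reflect_snd_mod L n 1 1
    have hm : (L - 1 % L) % L = L - 1 := by
      rw [Nat.mod_eq_of_lt (by omega : 1 < L), Nat.mod_eq_of_lt (by omega : L - 1 < L)]
    rw [hm] at hr
    rw [hr, heisRedCorr2]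
  rw [h1, h2, hc, show heisGroundCorr 0 L n 0 ![((1 : ℕ) : ZMod L), ((1 : ℕ) : ZMod L)] =
    heisRedCorr2 L n 1 1 from rfl]
  ring

/-! ### The diagonal kernel and its punctured Riemann sum -/

/-- **The three-sum-rule multiplier** `K(q) = a cos q₁ cos q₂ + b (cos q₁ + cos q₂)/2 + t` on the square
dual torus: the combination `a`·(D) `+ b`·(3) `+ t`·(2) has `Σ_q K(q) ĝ_q` on the left; `K(Q) = a - b + t`.
[Kennedy–Lieb–Shastry 1988, eqs. (6)–(9) (the two-weight family `t`)] [folklore] -/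
def klsDiagKernel (a b t : ℝ) (L : ℕ) (q : TorusSite 2 L) : ℝ :=
  a * (Real.cos (latticeMomentum L q 0) * Real.cos (latticeMomentum L q 1)) +
    b * (torusCosSum L q / 2) + t

/-- **The punctured Riemann sum of the diagonal bound**,
`𝓦(L) = L⁻² Σ_{q ≠ Q} {-K(q)}₊ (E_q/E_{q-Q})^{1/2}` (`E_q = Σᵢ (1 - cos qᵢ)`, `Q = (π, π)`; junk `0` at
`L = 0`) — a Riemann sum of a bounded continuous function whenever `K(Q) > 0` (the positive part of
`-K` then vanishes near the only singular point `Q` of `(E_q/E_{q-Q})^{1/2}`).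
[Kennedy–Lieb–Shastry 1988, eqs. (4), (6)–(9)] [folklore] -/
def klsDiagRiemannSum (a b t : ℝ) (L : ℕ) : ℝ :=
  if hL : L = 0 then 0
  else
    haveI : NeZero L := ⟨hL⟩
    (∑ q ∈ (univ : Finset (TorusSite 2 L)).erase (neelIndex L),
        max (-klsDiagKernel a b t L q) 0 *
          Real.sqrt (dispersion (latticeMomentum L q) /
            dispersion (latticeMomentum L (q - neelIndex L)))) / (L : ℝ) ^ 2

/-- Unfolding `𝓦(L)` on a genuine torus. [Kennedy–Lieb–Shastry 1988, eqs. (4), (6)–(9)]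
[cite: KLS1988JSP, eqs. (6)-(9)] -/
theorem klsDiagRiemannSum_of_neZero (a b t : ℝ) (L : ℕ) [NeZero L] :
    klsDiagRiemannSum a b t L =
      (∑ q ∈ (univ : Finset (TorusSite 2 L)).erase (neelIndex L),
          max (-klsDiagKernel a b t L q) 0 *
            Real.sqrt (dispersion (latticeMomentum L q) /
              dispersion (latticeMomentum L (q - neelIndex L)))) / (L : ℝ) ^ 2 := by
  simp [klsDiagRiemannSum, NeZero.ne L]

/-- `𝓦(L) ≥ 0`. [Kennedy–Lieb–Shastry 1988, eqs. (4), (6)–(9)] [cite: KLS1988JSP, eqs. (6)-(9)] -/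
theorem klsDiagRiemannSum_nonneg (a b t : ℝ) (L : ℕ) : 0 ≤ klsDiagRiemannSum a b t L := by
  rcases Nat.eq_zero_or_pos L with rfl | hL
  · simp [klsDiagRiemannSum]
  haveI : NeZero L := ⟨hL.ne'⟩
  rw [klsDiagRiemannSum_of_neZero]
  refine div_nonneg (sum_nonneg fun q _ => mul_nonneg (le_max_right _ _) (Real.sqrt_nonneg _)) ?_
  positivity

/-- `K(Q) = a - b + t` (`cos Qᵢ = -1`). [Kennedy–Lieb–Shastry 1988, eqs. (6)–(9)]
[cite: KLS1988JSP, eqs. (6)-(9)] -/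
theorem klsDiagKernel_neelIndex (a b t : ℝ) (k : ℕ) [NeZero (2 * k)] :
    klsDiagKernel a b t (2 * k) (neelIndex (2 * k)) = a - b + t := by
  rw [klsDiagKernel, torusCosSum_neelIndex k, latticeMomentum_neelIndex k,
    latticeMomentum_neelIndex k, Real.cos_pi]
  push_cast
  ring

/-! ### The three-sum-rule bound -/

/-- **The diagonal (three-sum-rule) Kennedy–Lieb–Shastry bound in finite volume, Néel term retained.**
For the spin-`n/2` antiferromagnet on the square torus of even side `2k ≥ 4` and all real `a, b, t`:
`K(Q) |Λ|⁻¹ ĝ_Q - (-ε/2)^{1/2} 𝓦(L) ≤ a c(1,1) + b ε + t S(S+1)/3`.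
Proof: `a`·(D) `+ b`·(3) `+ t`·(2) is `|Λ|(a c(1,1) + bε + t S(S+1)/3) = K(Q) ĝ_Q + Σ_{q ≠ Q} K(q) ĝ_q`
and each `q ≠ Q` term is `≥ -{-K(q)}₊ f_q` by the infrared bound (1) (`0 ≤ ĝ_q ≤ f_q`,
`heis_infraredBound`). [Kennedy–Lieb–Shastry 1988, eqs. (1)–(3), (6)–(9)] [cite: KLS1988JSP, eqs. (6)-(9)] -/
theorem kls_heis_diagSumRule (n k : ℕ) (hk : 2 ≤ k) (a b t : ℝ) :
    (a - b + t) * (heisStructureFactor 0 (2 * k) n (neelIndex (2 * k) : TorusSite 2 (2 * k)) /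
        ((2 * k : ℕ) : ℝ) ^ 2) -
        Real.sqrt (-heisBondCorr (d := 2) 0 (2 * k) n / 2) * klsDiagRiemannSum a b t (2 * k) ≤
      a * heisRedCorr2 (2 * k) n 1 1 + b * heisBondCorr (d := 2) 0 (2 * k) n +
        t * ((n : ℝ) / 2 * ((n : ℝ) / 2 + 1) / 3) := by
  haveI : NeZero (2 * k) := ⟨by omega⟩
  have hd : 1 ≤ 2 := by norm_num
  have h2k : (0 : ℝ) < ((2 * k : ℕ) : ℝ) := by exact_mod_cast (show 0 < 2 * k by omega)
  have hL : (0 : ℝ) < ((2 * k : ℕ) : ℝ) ^ 2 := pow_pos h2k 2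
  set Q : TorusSite 2 (2 * k) := neelIndex (2 * k) with hQ
  set ε := heisBondCorr (d := 2) 0 (2 * k) n with hε
  set s := -ε / 2 with hs_def
  set c := (n : ℝ) / 2 * ((n : ℝ) / 2 + 1) / 3 with hc
  set c11 := heisRedCorr2 (2 * k) n 1 1 with hc11
  set g : TorusSite 2 (2 * k) → ℝ := fun q => heisStructureFactor 0 (2 * k) n q with hg
  -- `s ≥ 0` from the Néel bound
  have hN := heisBondCorr_le (d := 2) hd n k hk
  have hs : 0 ≤ s := by
    rw [hs_def]
    have : 0 ≤ ((n : ℝ) / 2) ^ 2 / 3 := by positivity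
    linarith
  -- (3): `ε |Λ| = -ĝ_Q + Σ_{q ≠ Q} ĝ_q (cos q₁ + cos q₂)/2`
  have hE : ε * ((2 * k : ℕ) : ℝ) ^ 2 =
      -g Q + ∑ q ∈ (univ : Finset (TorusSite 2 (2 * k))).erase Q,
        g q * (torusCosSum (2 * k) q / 2) := by
    have h := heis_sumRule_split (d := 2) hd 0 k n
    rw [← hε, ← hQ] at h
    simpa only [hg, Nat.cast_ofNat] using h
  -- (2): `|Λ| S(S+1)/3 = ĝ_Q + Σ_{q ≠ Q} ĝ_q`
  have hT : ((2 * k : ℕ) : ℝ) ^ 2 * c =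
      g Q + ∑ q ∈ (univ : Finset (TorusSite 2 (2 * k))).erase Q, g q := by
    rw [hc, ← heis_structureFactor_totalSumRule (2 * k) n, ← add_sum_erase _ _ (mem_univ Q)]
  -- (D): `|Λ| c(1,1) = ĝ_Q + Σ_{q ≠ Q} ĝ_q cos q₁ cos q₂` (`cos Q₁ cos Q₂ = 1`)
  have hD : ((2 * k : ℕ) : ℝ) ^ 2 * c11 =
      g Q + ∑ q ∈ (univ : Finset (TorusSite 2 (2 * k))).erase Q,
        g q * (Real.cos (latticeMomentum (2 * k) q 0) * Real.cos (latticeMomentum (2 * k) q 1)) := by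
    rw [hc11, ← heis_structureFactor_diagSumRule_two (2 * k) (by omega) n,
      ← add_sum_erase _ _ (mem_univ Q)]
    congr 1
    rw [hQ, latticeMomentum_neelIndex k, latticeMomentum_neelIndex k, Real.cos_pi]
    ring
  -- the combination `a·(D) + b·(3) + t·(2)`
  have hK : ∑ q ∈ (univ : Finset (TorusSite 2 (2 * k))).erase Q, g q * klsDiagKernel a b t (2 * k) q =
      a * ∑ q ∈ (univ : Finset (TorusSite 2 (2 * k))).erase Q,
          g q * (Real.cos (latticeMomentum (2 * k) q 0) * Real.cos (latticeMomentum (2 * k) q 1)) +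
        b * ∑ q ∈ (univ : Finset (TorusSite 2 (2 * k))).erase Q,
          g q * (torusCosSum (2 * k) q / 2) +
        t * ∑ q ∈ (univ : Finset (TorusSite 2 (2 * k))).erase Q, g q := by
    rw [mul_sum, mul_sum, mul_sum, ← sum_add_distrib, ← sum_add_distrib]
    refine sum_congr rfl fun q _ => ?_
    rw [klsDiagKernel]
    ring
  have hcomb : ((2 * k : ℕ) : ℝ) ^ 2 * (a * c11 + b * ε + t * c) =
      (a - b + t) * g Q +
        ∑ q ∈ (univ : Finset (TorusSite 2 (2 * k))).erase Q, g q * klsDiagKernel a b t (2 * k) q := by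
    rw [hK]
    linear_combination a * hD + b * hE + t * hT
  -- termwise infrared bound on the punctured sum
  have hterm : ∀ q ∈ (univ : Finset (TorusSite 2 (2 * k))).erase Q,
      -(Real.sqrt s * (max (-klsDiagKernel a b t (2 * k) q) 0 *
          Real.sqrt (dispersion (latticeMomentum (2 * k) q) /
            dispersion (latticeMomentum (2 * k) (q - Q))))) ≤
        g q * klsDiagKernel a b t (2 * k) q := by
    intro q hq
    have hqQ : q ≠ Q := (mem_erase.1 hq).1
    obtain ⟨hgq, hAq⟩ := heis_infraredBound (d := 2) (by norm_num) n k hk q hqQ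
    have hE' : 0 < dispersion (latticeMomentum (2 * k) (q - Q)) :=
      dispersion_latticeMomentum_pos (sub_ne_zero.2 hqQ)
    rw [← hε] at hAq
    have h := kls_heis_pointwise11 (K := -klsDiagKernel a b t (2 * k) q) hgq hE' hs hAq
    rw [hg]
    linarith
  have hsum := sum_le_sum hterm
  rw [sum_neg_distrib, ← mul_sum] at hsum
  rw [klsDiagRiemannSum_of_neZero, ← hQ]
  -- divide the combination by `|Λ|`
  have hgoal : (a - b + t) * (g Q / ((2 * k : ℕ) : ℝ) ^ 2) -
      Real.sqrt s * ((∑ q ∈ (univ : Finset (TorusSite 2 (2 * k))).erase Q,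
        max (-klsDiagKernel a b t (2 * k) q) 0 *
          Real.sqrt (dispersion (latticeMomentum (2 * k) q) /
            dispersion (latticeMomentum (2 * k) (q - Q)))) / ((2 * k : ℕ) : ℝ) ^ 2) =
      ((a - b + t) * g Q - Real.sqrt s * ∑ q ∈ (univ : Finset (TorusSite 2 (2 * k))).erase Q,
        max (-klsDiagKernel a b t (2 * k) q) 0 *
          Real.sqrt (dispersion (latticeMomentum (2 * k) q) /
            dispersion (latticeMomentum (2 * k) (q - Q)))) / ((2 * k : ℕ) : ℝ) ^ 2 := by
    field_simp
  have hgQ : g Q = heisStructureFactor 0 (2 * k) n Q := rfl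
  rw [← hgQ, hgoal, div_le_iff₀ hL]
  have hfin : (a * c11 + b * ε + t * c) * ((2 * k : ℕ) : ℝ) ^ 2 =
      (a - b + t) * g Q +
        ∑ q ∈ (univ : Finset (TorusSite 2 (2 * k))).erase Q, g q * klsDiagKernel a b t (2 * k) q := by
    rw [← hcomb]; ring
  rw [hfin]
  linarith [hsum]

/-- **Dropping the Néel term.** If `K(Q) = a - b + t ≥ 0` then, since `ĝ_Q ≥ 0`
(`heisStructureFactor_nonneg`), `b(-ε) - t S(S+1)/3 - (-ε/2)^{1/2} 𝓦(L) ≤ a c(1,1)` on every square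
torus of even side `2k ≥ 4` (a lower bound on the diagonal correlation from the infrared bound and the
three sum rules, with the nearest-neighbour correlation `ε` as the only unknown).
[Kennedy–Lieb–Shastry 1988, eqs. (1)–(3), (6)–(9)] [cite: KLS1988JSP, eqs. (6)-(9)] -/
theorem kls_heis_diagSumRule_drop (n k : ℕ) (hk : 2 ≤ k) {a b t : ℝ} (hK : 0 ≤ a - b + t) :
    b * (-heisBondCorr (d := 2) 0 (2 * k) n) - t * ((n : ℝ) / 2 * ((n : ℝ) / 2 + 1) / 3) -
        Real.sqrt (-heisBondCorr (d := 2) 0 (2 * k) n / 2) * klsDiagRiemannSum a b t (2 * k) ≤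
      a * heisRedCorr2 (2 * k) n 1 1 := by
  haveI : NeZero (2 * k) := ⟨by omega⟩
  have hmain := kls_heis_diagSumRule n k hk a b t
  have hg : 0 ≤ heisStructureFactor 0 (2 * k) n (neelIndex (2 * k) : TorusSite 2 (2 * k)) /
      ((2 * k : ℕ) : ℝ) ^ 2 :=
    div_nonneg (heisStructureFactor_nonneg (2 * k) n _) (by positivity)
  have hQ : 0 ≤ (a - b + t) * (heisStructureFactor 0 (2 * k) n
      (neelIndex (2 * k) : TorusSite 2 (2 * k)) / ((2 * k : ℕ) : ℝ) ^ 2) := mul_nonneg hK hg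
  linarith

/-- **The energy-free diagonal bound.** For `b > 0` and `K(Q) = a - b + t ≥ 0`, minimising the
dropped bound over the unknown `-ε ≥ 0` (arithmetic–geometric mean,
`2b y² - y 𝓦 ≥ -𝓦²/(8b)` at `y = (-ε/2)^{1/2}`):
`-t S(S+1)/3 - 𝓦(L)²/(8b) ≤ a c(1,1)` for the spin-`n/2` antiferromagnet on every square torus of even
side `2k ≥ 4` — no information on the ground-state energy is used. [Kennedy–Lieb–Shastry 1988,
eqs. (6)–(9) (with `e₀` eliminated)] [cite: KLS1988JSP, eqs. (6)-(9)] -/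
theorem kls_heis_diagCorr_lower_energyFree (n k : ℕ) (hk : 2 ≤ k) {a b t : ℝ} (hb : 0 < b)
    (hK : 0 ≤ a - b + t) :
    -t * ((n : ℝ) / 2 * ((n : ℝ) / 2 + 1) / 3) - klsDiagRiemannSum a b t (2 * k) ^ 2 / (8 * b) ≤
      a * heisRedCorr2 (2 * k) n 1 1 := by
  haveI : NeZero (2 * k) := ⟨by omega⟩
  have hmain := kls_heis_diagSumRule_drop n k hk (a := a) (b := b) (t := t) hK
  set u := -heisBondCorr (d := 2) 0 (2 * k) n with hu
  set W := klsDiagRiemannSum a b t (2 * k) with hW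
  have hN := heisBondCorr_le (d := 2) (by norm_num) n k hk
  have hu0 : 0 ≤ u / 2 := by
    rw [hu]
    have : 0 ≤ ((n : ℝ) / 2) ^ 2 / 3 := by positivity
    linarith
  set y := Real.sqrt (u / 2) with hy
  have hy2 : y ^ 2 = u / 2 := Real.sq_sqrt hu0
  have key : 2 * b * y ^ 2 - y * W + W ^ 2 / (8 * b) = (4 * b * y - W) ^ 2 / (8 * b) := by
    field_simp
    ring
  have hpos : 0 ≤ (4 * b * y - W) ^ 2 / (8 * b) := by positivity
  have : b * u = 2 * b * y ^ 2 := by rw [hy2]; ring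
  nlinarith [hmain, key, hpos, this]

/-- **Spin ½, unit diagonal weight** (the form used by the HubbardLadder cell's device D33): for every
even side `L = 2k ≥ 4` and all real `b > 0`, `t` with `1 - b + t ≥ 0`,
`-t/4 - 𝓦_{1,b,t}(L)²/(8b) ≤ c_L(1,1) = ⟨Sᶻ_0 Sᶻ_(1,1)⟩_L`, where `𝓦` is the explicit finite sum
`klsDiagRiemannSum 1 b t L`. With `(b, t) = (0.6247, -0.3229)` the left side evaluates (outside Lean)
to `≥ 0.0207` at `L = 48` and `≥ 0.0183` for every even `L ≥ 4` (device D33, numerics of record; the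
evaluation of `𝓦(L)` is NOT part of this theorem). [Kennedy–Lieb–Shastry 1988, eqs. (6)–(9), p. 1023]
[cite: KLS1988JSP, eqs. (6)-(9)] -/
theorem heisRedCorr2_diag_lower_energyFree (k : ℕ) (hk : 2 ≤ k) {b t : ℝ} (hb : 0 < b)
    (hK : 0 ≤ 1 - b + t) :
    -t / 4 - klsDiagRiemannSum 1 b t (2 * k) ^ 2 / (8 * b) ≤ heisRedCorr2 (2 * k) 1 1 1 := by
  have h := kls_heis_diagCorr_lower_energyFree 1 k hk (a := 1) hb hK
  norm_num at h
  linarith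

/-- **An upper bound on the Néel order parameter from the diagonal correlation** (the retained form read
the other way): if `K(Q) = a - b + t > 0` then
`|Λ|⁻¹ ĝ_Q ≤ (a c(1,1) + b ε + t S(S+1)/3 + (-ε/2)^{1/2} 𝓦(L)) / K(Q)` on every square torus of even
side `2k ≥ 4`. [Kennedy–Lieb–Shastry 1988, eqs. (6)–(9)] [cite: KLS1988JSP, eqs. (6)-(9)] -/
theorem heis_neelParameter_le_of_diag (n k : ℕ) (hk : 2 ≤ k) {a b t : ℝ} (hK : 0 < a - b + t) :
    heisStructureFactor 0 (2 * k) n (neelIndex (2 * k) : TorusSite 2 (2 * k)) / ((2 * k : ℕ) : ℝ) ^ 2 ≤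
      (a * heisRedCorr2 (2 * k) n 1 1 + b * heisBondCorr (d := 2) 0 (2 * k) n +
          t * ((n : ℝ) / 2 * ((n : ℝ) / 2 + 1) / 3) +
        Real.sqrt (-heisBondCorr (d := 2) 0 (2 * k) n / 2) * klsDiagRiemannSum a b t (2 * k)) /
        (a - b + t) := by
  have hmain := kls_heis_diagSumRule n k hk a b t
  rw [le_div_iff₀ hK]
  linarith

end Literature.MathematicalPhysics.QuantumLattice
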